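import Literature.Computability.MetaComplexity.EFModAddSplit
import HarnessLib

/-!
# Modular addition in extended Frege: the rules of the associativity law

Layer D/4a of the `EF`-proof construction kit. The associativity of modular addition
(`EFModAddAssoc*.lean`) is assembled from: the split identities of the four occurrences
(`EFModAddSplit.lean`), an identity `(L + G₂n) + G₁n = (x + y) + z = x + (y + z) = (R + G₄n) + G₃n`
between ordinary sums (adder algebra), the equality of the "quotients" `G₁ + G₂ = G₃ + G₄` (from
the certificates `L, R < n`, by comparison with `n` and `2n`), and a final induction along the bit
positions cancelling the equal multiples of `n`. This file fixes the constant-size sound rules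
these steps use beyond the earlier layers, and the bundle `ModAdd.ARulesOK`:

* `rSumCC`, `rCarryFF`: an adder position whose two operand bits are (possibly different) false
  bits passes its carry to the sum bit and produces no carry;
* `rMonoPos`: the positive end of the monotonicity invariant `Sub.monoF` (`x ≥ y ⟹ x + z ≥ y + z`);
* six introduction rules for `g ↔ (a ∨ b)` and `g ↔ (a ∧ b)` from literals;
* `rQuot`: from `G₁ ↔ (s₁ ∨ s₂)`, `G₂ ↔ (s₁ ∧ s₂)`, the same for `G₁', G₂'` over `s₃, s₄`, and
  `G₁ ↔ G₁'`, `G₂ ↔ G₂'`, the equality of quotients `s₁ + s₂ = s₃ + s₄` in the form `Adder.invF`;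
* `rCancStep`, `rCancEq`: the step of the cancellation induction — from the carry invariant
  `c₁ + c₂ = c₃ + c₄` (`Adder.invF`), the quotient equality, the four mask definitions
  `mⱼ ↔ (sⱼ ∧ nᵢ)`, the sum and carry definitions of the four adders at position `i` and the
  equality of the two outer sum bits, infer the invariant at the next position and `Lᵢ ↔ Rᵢ`
  (verified by `FregeRule.checkD` over the 12 free metavariables).

## Sources

* S. A. Cook, R. A. Reckhow, *The relative efficiency of propositional proof systems*,
  J. Symbolic Logic 44 (1979), §2 (sound schematic rules).
-/

namespace Literature.Computability.MetaComplexity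

open _root_.Computability Complexity Complexity.PropForm FregeSystem Netlist

namespace ModAdd

namespace Assoc

/-- Sum bit over two false operand bits: `s = a ⊕ b ⊕ c`, `¬a`, `¬b` give `s ↔ c`.
[cite: CookReckhow1979, §2 (sound rule)] -/
def rSumCC : FregeRule :=
  ⟨[ctx (var 0) (biimp (var 1) (xor3F (var 2) (var 3) (var 4))), ctx (var 0) (neg (var 2)), ctx (var 0) (neg (var 3))],
   ctx (var 0) (eqv 1 4)⟩

/-- Carry over two false operand bits: `c' = maj(a, b, c)`, `¬a`, `¬b` give `¬c'`.
[cite: CookReckhow1979, §2 (sound rule)] -/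
def rCarryFF : FregeRule :=
  ⟨[ctx (var 0) (biimp (var 1) (majF (var 2) (var 3) (var 4))), ctx (var 0) (neg (var 2)), ctx (var 0) (neg (var 3))],
   ctx (var 0) (neg (var 1))⟩

/-- The positive end of monotonicity: from the invariant `monoF α p q δ` at the top, `α` (`x ≥ y`),
the complement `nt ↔ ¬q` and the top comparison carry `δ' = maj(p, nt, δ)` infer `δ'`
(`x + z ≥ y + z`). [cite: CookReckhow1979, §2 (sound rule)] -/
def rMonoPos : FregeRule :=
  ⟨[ctx (var 0) (Sub.monoF (var 1) (var 2) (var 3) (var 4)), ctx (var 0) (var 1),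
    ctx (var 0) (biimp (var 5) (neg (var 3))), ctx (var 0) (biimp (var 6) (majF (var 2) (var 5) (var 4)))],
   ctx (var 0) (var 6)⟩

/-- `g`, `a` give `g ↔ (a ∨ b)`. [cite: CookReckhow1979, §2 (sound rule)] -/
def rOrI1 : FregeRule := ⟨[ctx (var 0) (var 1), ctx (var 0) (var 2)], ctx (var 0) (biimp (var 1) (disj (var 2) (var 3)))⟩
/-- `g`, `b` give `g ↔ (a ∨ b)`. [cite: CookReckhow1979, §2 (sound rule)] -/
def rOrI2 : FregeRule := ⟨[ctx (var 0) (var 1), ctx (var 0) (var 3)], ctx (var 0) (biimp (var 1) (disj (var 2) (var 3)))⟩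
/-- `¬g`, `¬a`, `¬b` give `g ↔ (a ∨ b)`. [cite: CookReckhow1979, §2 (sound rule)] -/
def rOrI0 : FregeRule :=
  ⟨[ctx (var 0) (neg (var 1)), ctx (var 0) (neg (var 2)), ctx (var 0) (neg (var 3))], ctx (var 0) (biimp (var 1) (disj (var 2) (var 3)))⟩
/-- `g`, `a`, `b` give `g ↔ (a ∧ b)`. [cite: CookReckhow1979, §2 (sound rule)] -/
def rAndI1 : FregeRule :=
  ⟨[ctx (var 0) (var 1), ctx (var 0) (var 2), ctx (var 0) (var 3)], ctx (var 0) (biimp (var 1) (conj (var 2) (var 3)))⟩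
/-- `¬g`, `¬a` give `g ↔ (a ∧ b)`. [cite: CookReckhow1979, §2 (sound rule)] -/
def rAndI0a : FregeRule := ⟨[ctx (var 0) (neg (var 1)), ctx (var 0) (neg (var 2))], ctx (var 0) (biimp (var 1) (conj (var 2) (var 3)))⟩
/-- `¬g`, `¬b` give `g ↔ (a ∧ b)`. [cite: CookReckhow1979, §2 (sound rule)] -/
def rAndI0b : FregeRule := ⟨[ctx (var 0) (neg (var 1)), ctx (var 0) (neg (var 3))], ctx (var 0) (biimp (var 1) (conj (var 2) (var 3)))⟩

/-- **Equality of quotients**: from `G₁ ↔ (s₁ ∨ s₂)`, `G₂ ↔ (s₁ ∧ s₂)`, `G₁' ↔ (s₃ ∨ s₄)`,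
`G₂' ↔ (s₃ ∧ s₄)`, `G₁ ↔ G₁'`, `G₂ ↔ G₂'` infer `s₁ + s₂ = s₃ + s₄` (`Adder.invF`).
[cite: CookReckhow1979, §2 (sound rule)] -/
def rQuot : FregeRule :=
  ⟨[ctx (var 0) (biimp (var 1) (disj (var 5) (var 6))), ctx (var 0) (biimp (var 2) (conj (var 5) (var 6))),
    ctx (var 0) (biimp (var 3) (disj (var 7) (var 8))), ctx (var 0) (biimp (var 4) (conj (var 7) (var 8))),
    ctx (var 0) (eqv 1 3), ctx (var 0) (eqv 2 4)],
   ctx (var 0) (Adder.invF (var 5) (var 6) (var 7) (var 8))⟩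

/-- The premises of the cancellation step at one position (metavariables: carries `c₁…c₄ = 1…4`,
selectors `s₁…s₄ = 5…8`, `Lᵢ = 9`, `Rᵢ = 10`, `nᵢ = 11`; defined: masks `m₂ m₁ m₄ m₃ = 12…15`,
inner sum/carry `a = 16`, `c₁' = 17`, outer `v = 18`, `c₂' = 19`, right `b = 20`, `c₃' = 21`,
`v' = 22`, `c₄' = 23`). [folklore] -/
def cancPrems : List (PropForm ℕ) :=
  [ctx (var 0) (Adder.invF (var 1) (var 2) (var 3) (var 4)), ctx (var 0) (Adder.invF (var 5) (var 6) (var 7) (var 8)),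
    ctx (var 0) (biimp (var 12) (conj (var 6) (var 11))), ctx (var 0) (biimp (var 13) (conj (var 5) (var 11))),
    ctx (var 0) (biimp (var 14) (conj (var 8) (var 11))), ctx (var 0) (biimp (var 15) (conj (var 7) (var 11))),
    ctx (var 0) (biimp (var 16) (xor3F (var 9) (var 12) (var 1))), ctx (var 0) (biimp (var 17) (majF (var 9) (var 12) (var 1))),
    ctx (var 0) (biimp (var 18) (xor3F (var 16) (var 13) (var 2))), ctx (var 0) (biimp (var 19) (majF (var 16) (var 13) (var 2))),
    ctx (var 0) (biimp (var 20) (xor3F (var 10) (var 14) (var 3))), ctx (var 0) (biimp (var 21) (majF (var 10) (var 14) (var 3))),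
    ctx (var 0) (biimp (var 22) (xor3F (var 20) (var 15) (var 4))), ctx (var 0) (biimp (var 23) (majF (var 20) (var 15) (var 4))),
    ctx (var 0) (eqv 18 22)]

/-- **The cancellation step, invariant part**: the carry invariant propagates.
[cite: CookReckhow1979, §2 (sound rule)] -/
def rCancStep : FregeRule := ⟨cancPrems, ctx (var 0) (Adder.invF (var 17) (var 19) (var 21) (var 23))⟩

/-- **The cancellation step, conclusion part**: `Lᵢ ↔ Rᵢ`. [cite: CookReckhow1979, §2 (sound rule)] -/
def rCancEq : FregeRule := ⟨cancPrems, ctx (var 0) (eqv 9 10)⟩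

/-- The definition list of the cancellation step for `FregeRule.checkD`. [folklore] -/
def dsCanc : List (ℕ × PropForm ℕ) :=
  [(12, conj (var 6) (var 11)), (13, conj (var 5) (var 11)), (14, conj (var 8) (var 11)), (15, conj (var 7) (var 11)),
    (16, xor3F (var 9) (var 12) (var 1)), (17, majF (var 9) (var 12) (var 1)), (18, xor3F (var 16) (var 13) (var 2)),
    (19, majF (var 16) (var 13) (var 2)), (20, xor3F (var 10) (var 14) (var 3)), (21, majF (var 10) (var 14) (var 3)),
    (22, xor3F (var 20) (var 15) (var 4)), (23, majF (var 20) (var 15) (var 4))]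

/-- Soundness check of the invariant part of the cancellation step (12 free metavariables).
[cite: CookReckhow1979, §2 (sound rule)] -/
theorem checkD_rCancStep : rCancStep.checkD 12 dsCanc = true := by decide +kernel

/-- Soundness check of the conclusion part of the cancellation step.
[cite: CookReckhow1979, §2 (sound rule)] -/
theorem checkD_rCancEq : rCancEq.checkD 12 dsCanc = true := by decide +kernel

/-- Soundness check of the positive end of monotonicity (definitions `nt`, `δ'`).
[cite: CookReckhow1979, §2 (sound rule)] -/
theorem checkD_rMonoPos : rMonoPos.checkD 5 [(5, neg (var 3)), (6, majF (var 2) (var 5) (var 4))] = true := by decide +kernel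

/-- The rules of the associativity development. [cite: CookReckhow1979, §2] -/
def rules : List FregeRule :=
  [rSumCC, rCarryFF, rMonoPos, rOrI1, rOrI2, rOrI0, rAndI1, rAndI0a, rAndI0b, rQuot, rCancStep, rCancEq]

/-- Every rule of the associativity development is sound. [cite: CookReckhow1979, §2 (sound rule)] -/
theorem isSound_of_mem_rules : ∀ r ∈ rules, r.IsSound := by
  intro r hr
  simp only [rules, List.mem_cons, List.not_mem_nil, or_false] at hr
  rcases hr with rfl | rfl | rfl | rfl | rfl | rfl | rfl | rfl | rfl | rfl | rfl | rfl
  · exact FregeRule.isSound_of_check (by decide +kernel)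
  · exact FregeRule.isSound_of_check (by decide +kernel)
  · exact FregeRule.isSound_of_checkD checkD_rMonoPos
  · exact FregeRule.isSound_of_check (by decide +kernel)
  · exact FregeRule.isSound_of_check (by decide +kernel)
  · exact FregeRule.isSound_of_check (by decide +kernel)
  · exact FregeRule.isSound_of_check (by decide +kernel)
  · exact FregeRule.isSound_of_check (by decide +kernel)
  · exact FregeRule.isSound_of_check (by decide +kernel)
  · exact FregeRule.isSound_of_check (by decide +kernel)
  · exact FregeRule.isSound_of_checkD checkD_rCancStep
  · exact FregeRule.isSound_of_checkD checkD_rCancEq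

/-- Membership in `rules`, by position. [folklore] -/
theorem mem_rules (i : ℕ) (hi : i < rules.length) : rules[i] ∈ rules := List.getElem_mem hi

end Assoc

/-- `ARulesOK G`: the rule list `G` contains all layers used by the associativity of modular
addition. [folklore] -/
structure ARulesOK (G : FregeSystem) : Prop extends RulesOK G where
  /-- the rules of the associativity development -/
  assoc : ∀ r ∈ Assoc.rules, r ∈ G.rules

/-- All rule layers so far, including the associativity rules. [folklore] -/
def allRulesA : List FregeRule := allRules ++ Assoc.rules

/-- `allRulesA` contains every layer. [folklore] -/
theorem aRulesOK_allRulesA : ARulesOK ⟨allRulesA⟩ := by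
  have h := rulesOK_allRules
  refine ⟨⟨?_, ?_, ?_, ?_, ?_, ?_, ?_, ?_⟩, ?_⟩ <;> intro r hr <;> simp only [allRulesA, List.mem_append]
  exacts [Or.inl (h.netlist r hr), Or.inl (h.logic r hr), Or.inl (h.adder r hr), Or.inl (h.adderLaw r hr),
    Or.inl (h.sub r hr), Or.inl (h.order r hr), Or.inl (h.muxNat r hr), Or.inl (h.modAdd r hr), Or.inr hr]

/-- Every rule of `allRulesA` is sound. [cite: CookReckhow1979, §2 (sound rule)] -/
theorem isSound_allRulesA : ∀ r ∈ allRulesA, r.IsSound := by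
  intro r hr
  rcases List.mem_append.1 hr with hr | hr
  exacts [isSound_allRules r hr, Assoc.isSound_of_mem_rules r hr]

namespace Assoc

variable {G : FregeSystem} {Γ : Set (PropForm ℕ)}

/-- One inference by the `i`-th rule of the associativity development (explicit conclusion,
premises to be found). [cite: CookReckhow1979, §2] -/
theorem infer (hG : ARulesOK G) (i : ℕ) (hi : i < rules.length) {S : Set (PropForm ℕ)} (σ : ℕ → PropForm ℕ)
    {θ : PropForm ℕ} (hθ : (rules[i]).conclusion.subst σ = θ) (hp : ∀ p ∈ (rules[i]).premises, p.subst σ ∈ S) :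
    G.IsInferredFrom S θ :=
  FregeSystem.IsInferredFrom.of_rule (hG.assoc _ (List.getElem_mem hi)) σ hθ hp

end Assoc

end ModAdd

end Literature.Computability.MetaComplexity
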